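import Summits.BirchSwinnertonDyer.BirchSwinnertonDyer.Theorems.ByReductionTypeAtTwoRankOneSigmaHeightLevelOneLaw
import Summits.BirchSwinnertonDyer.BirchSwinnertonDyer.Theorems.ByReductionTypeAtTwoRankOneSigmaHeightLevelOneClosure
import Summits.BirchSwinnertonDyer.BirchSwinnertonDyer.Theorems.ByReductionTypeAtTwoRankOneSigmaHeightNeronDuplication
import HarnessLib

/-!
# Route `ByReductionTypeAtTwo`, crux `RankOneAtTwoBigImageOddLocal` (item stmt-BirchSwinnertonDyer-23715), line AN62, σ₀-LEMMA BLOCK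
# (cell `bsd-f1-sign2`, planner seat `-an` g50; `--supports 23715`, helper):
# **THE LEVEL-ONE LAW FOR THE σ-FORM 2-ADIC HEIGHT, UNCONDITIONAL: `‖D(Q,Q) − log₂ num x(Q) + 8a₄‖₂ ≤ 1/32` at `‖x(Q)‖₂ = 4`,
# hence `‖D(Q,Q)‖₂ = ¼ ⟺ a₂ odd` (CensusAN52: 1 639/1 639 level-one rows)**

HONEST FRAMING (D-0036/D-0054): THEOREMS ONLY (no definition, no named fact, no `sorry`, no instance).  `V/ℚ` `ℤ`-integral with `a₁ = 0`,
`Sq` a solution of the `σ²`-ODE at `c = 0` normalised `Sq = T² + O(T⁴)`, `D : PAdicHeightData V 2` ANY datum whose pairing has the σ-form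
`D(P,P) = log₂ den x(P) − log₂ Sq(−x/y)` on the local-conditions locus (`hD`; the `η`-datum of the AN62 workfile is one).  For `Q = (x, y)`
with `‖x‖₂ = 4` (level one) and non-singular reduction at every prime, the three inputs — the level-one law given a duplication numerator
(`…SigmaHeightLevelOneLaw`), the closure of the locus under doubling (`…SigmaHeightLevelOneClosure`) and Néron's duplication numerator
(`…SigmaHeightNeronDuplication`) — assemble to the unconditional law `norm_pairing_sub_padicLog_num_add_le_of_norm_eq_four` and its corollaries
`norm_pairing_le_quarter_of_norm_eq_four`, `norm_pairing_eq_quarter_iff_of_norm_eq_four` (`= ¼ ⟺ a₂` odd), `pairing_ne_zero_of_norm_eq_four`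
(`a₂` odd ⟹ `D(Q,Q) ≠ 0`).  This was typed candidate 54B `EtaHeightLevelOneLawAtTwo` (MEMO-an v2.17 §54; census 840/840, `v₂ = 5` exactly in
403 rows).  Nothing here is a statement about `BSDp`; item 23715 stays OPEN; BSD is proved for no curve.

PLACEMENT: the `p = 2`, level-one companion of [cite: MazurSteinTate2006, §1 (1.1), §2.6] / Harvey 2008 §5 (odd `p`, level `≥ 1`): there the
height is read off `log_p` of the DENOMINATOR to first order; here, at `p = 2` and `‖x‖₂ = 4` (outside the convergence disc of the naive σ), it is
`log₂` of the NUMERATOR shifted by `8a₄ (mod 32)`.  References: [cite: MazurSteinTate2006, §1, §2.6] [cite: SilvermanAEC2009, III.2.3(d), VII.2].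
-/

set_option autoImplicit false

noncomputable section

open scoped Classical

open WeierstrassCurve PowerSeries Literature Literature.NumberTheory.EllipticCurves

namespace Summit.BirchSwinnertonDyer.BirchSwinnertonDyer.Theorems

namespace NaiveSigmaLogAtTwo

/-- **The level-one law, unconditional** (54B): `‖D(Q,Q) − log₂ num x + 8a₄‖₂ ≤ 1/32` for `Q = (x, y)` with `‖x‖₂ = 4` and non-singular
reduction at every prime. [cite: MazurSteinTate2006, §1, §2.6] [cite: SilvermanAEC2009, III.2.3(d)] -/
theorem norm_pairing_sub_padicLog_num_add_le_of_norm_eq_four (V : WeierstrassCurve ℚ) [V.IsIntegral ℤ] (ha1 : V.a₁ = 0)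
    (Sq : ℚ_[2]⟦X⟧) (h0 : constantCoeff Sq = 0) (h1 : coeff 1 Sq = 0) (h2 : coeff 2 Sq = 1) (h3 : coeff 3 Sq = 0)
    (hODE : (V.baseChange ℚ_[2]).SatisfiesSigmaSqODE Sq 0) (D : PAdicHeightData V 2)
    (hD : ∀ {x y : ℚ} (h : V.toAffine.Nonsingular x y), V.SatisfiesLocalConditions 2 (.some x y h) →
      D.pairing (.some x y h) (.some x y h) = padicLog 2 ((x.den : ℚ) : ℚ_[2]) - padicLog 2 (padicEval Sq (-(x : ℚ_[2]) / y)))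
    {x y : ℚ} (h : V.toAffine.Nonsingular x y) (hx : ‖(x : ℚ_[2])‖ = 4)
    (hns : ∀ ℓ : ℕ, ℓ.Prime → V.HasNonsingularReductionAt ℓ x y) :
    ‖D.pairing (.some x y h) (.some x y h) - padicLog 2 (x.num : ℚ_[2]) + 8 * (V.a₄ : ℚ_[2])‖ ≤ 32⁻¹ := by
  obtain ⟨x', y', h', h2Q, hQ'⟩ := exists_two_nsmul_satisfiesLocalConditions_of_norm_eq_four V ha1 h hx hns
  have hN := num_two_nsmul_eq_neronNumerator V h h' hns h2Q
  have hb4 : V.b₄ = 2 * V.a₄ := by rw [WeierstrassCurve.b₄, ha1]; ring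
  have hb6 : V.b₆ = V.a₃ ^ 2 + 4 * V.a₆ := by rw [WeierstrassCurve.b₆]
  have hb8 : V.b₈ = 4 * V.a₂ * V.a₆ + V.a₂ * V.a₃ ^ 2 - V.a₄ ^ 2 := by rw [WeierstrassCurve.b₈, ha1]; ring
  rw [hb4, hb6, hb8] at hN
  have h2Q' : ((2 ^ 1 : ℕ)) • (.some x y h : V.toAffine.Point) = .some x' y' h' := by simpa using h2Q
  exact norm_pairing_sub_padicLog_num_add_le_of_duplication V ha1 Sq h0 h1 h2 h3 hODE D hD h h' h2Q' hQ' hx hN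

/-- Corollary: `‖D(Q,Q)‖₂ ≤ ¼` at level one. [cite: MazurSteinTate2006, §1, §2.6] -/
theorem norm_pairing_le_quarter_of_norm_eq_four (V : WeierstrassCurve ℚ) [V.IsIntegral ℤ] (ha1 : V.a₁ = 0)
    (Sq : ℚ_[2]⟦X⟧) (h0 : constantCoeff Sq = 0) (h1 : coeff 1 Sq = 0) (h2 : coeff 2 Sq = 1) (h3 : coeff 3 Sq = 0)
    (hODE : (V.baseChange ℚ_[2]).SatisfiesSigmaSqODE Sq 0) (D : PAdicHeightData V 2)
    (hD : ∀ {x y : ℚ} (h : V.toAffine.Nonsingular x y), V.SatisfiesLocalConditions 2 (.some x y h) →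
      D.pairing (.some x y h) (.some x y h) = padicLog 2 ((x.den : ℚ) : ℚ_[2]) - padicLog 2 (padicEval Sq (-(x : ℚ_[2]) / y)))
    {x y : ℚ} (h : V.toAffine.Nonsingular x y) (hx : ‖(x : ℚ_[2])‖ = 4)
    (hns : ∀ ℓ : ℕ, ℓ.Prime → V.HasNonsingularReductionAt ℓ x y) :
    ‖D.pairing (.some x y h) (.some x y h)‖ ≤ 4⁻¹ := by
  obtain ⟨x', y', h', h2Q, hQ'⟩ := exists_two_nsmul_satisfiesLocalConditions_of_norm_eq_four V ha1 h hx hns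
  have hN := num_two_nsmul_eq_neronNumerator V h h' hns h2Q
  have hb4 : V.b₄ = 2 * V.a₄ := by rw [WeierstrassCurve.b₄, ha1]; ring
  have hb6 : V.b₆ = V.a₃ ^ 2 + 4 * V.a₆ := by rw [WeierstrassCurve.b₆]
  have hb8 : V.b₈ = 4 * V.a₂ * V.a₆ + V.a₂ * V.a₃ ^ 2 - V.a₄ ^ 2 := by rw [WeierstrassCurve.b₈, ha1]; ring
  rw [hb4, hb6, hb8] at hN
  have h2Q' : ((2 ^ 1 : ℕ)) • (.some x y h : V.toAffine.Point) = .some x' y' h' := by simpa using h2Q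
  exact norm_pairing_le_quarter_of_duplication V ha1 Sq h0 h1 h2 h3 hODE D hD h h' h2Q' hQ' hx hN

/-- **`‖D(Q,Q)‖₂ = ¼ ⟺ a₂` odd** at level one (CensusAN52: 1 639/1 639 rows). [cite: MazurSteinTate2006, §1, §2.6] -/
theorem norm_pairing_eq_quarter_iff_of_norm_eq_four (V : WeierstrassCurve ℚ) [V.IsIntegral ℤ] (ha1 : V.a₁ = 0)
    (Sq : ℚ_[2]⟦X⟧) (h0 : constantCoeff Sq = 0) (h1 : coeff 1 Sq = 0) (h2 : coeff 2 Sq = 1) (h3 : coeff 3 Sq = 0)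
    (hODE : (V.baseChange ℚ_[2]).SatisfiesSigmaSqODE Sq 0) (D : PAdicHeightData V 2)
    (hD : ∀ {x y : ℚ} (h : V.toAffine.Nonsingular x y), V.SatisfiesLocalConditions 2 (.some x y h) →
      D.pairing (.some x y h) (.some x y h) = padicLog 2 ((x.den : ℚ) : ℚ_[2]) - padicLog 2 (padicEval Sq (-(x : ℚ_[2]) / y)))
    {x y : ℚ} (h : V.toAffine.Nonsingular x y) (hx : ‖(x : ℚ_[2])‖ = 4)
    (hns : ∀ ℓ : ℕ, ℓ.Prime → V.HasNonsingularReductionAt ℓ x y) (a2 : ℤ) (ha2 : V.a₂ = a2) :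
    ‖D.pairing (.some x y h) (.some x y h)‖ = 4⁻¹ ↔ Odd a2 := by
  obtain ⟨x', y', h', h2Q, hQ'⟩ := exists_two_nsmul_satisfiesLocalConditions_of_norm_eq_four V ha1 h hx hns
  have hN := num_two_nsmul_eq_neronNumerator V h h' hns h2Q
  have hb4 : V.b₄ = 2 * V.a₄ := by rw [WeierstrassCurve.b₄, ha1]; ring
  have hb6 : V.b₆ = V.a₃ ^ 2 + 4 * V.a₆ := by rw [WeierstrassCurve.b₆]
  have hb8 : V.b₈ = 4 * V.a₂ * V.a₆ + V.a₂ * V.a₃ ^ 2 - V.a₄ ^ 2 := by rw [WeierstrassCurve.b₈, ha1]; ring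
  rw [hb4, hb6, hb8] at hN
  have h2Q' : ((2 ^ 1 : ℕ)) • (.some x y h : V.toAffine.Point) = .some x' y' h' := by simpa using h2Q
  exact norm_pairing_eq_quarter_iff_of_duplication V ha1 Sq h0 h1 h2 h3 hODE D hD h h' h2Q' hQ' hx hN a2 ha2

/-- **Non-vanishing at level one for odd `a₂`**: `D(Q,Q) ≠ 0` (in particular the σ-form 2-adic height does not vanish at such a point of
infinite or finite order alike — a purely local statement). [cite: MazurSteinTate2006, §1, §2.6] -/
theorem pairing_ne_zero_of_norm_eq_four (V : WeierstrassCurve ℚ) [V.IsIntegral ℤ] (ha1 : V.a₁ = 0)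
    (Sq : ℚ_[2]⟦X⟧) (h0 : constantCoeff Sq = 0) (h1 : coeff 1 Sq = 0) (h2 : coeff 2 Sq = 1) (h3 : coeff 3 Sq = 0)
    (hODE : (V.baseChange ℚ_[2]).SatisfiesSigmaSqODE Sq 0) (D : PAdicHeightData V 2)
    (hD : ∀ {x y : ℚ} (h : V.toAffine.Nonsingular x y), V.SatisfiesLocalConditions 2 (.some x y h) →
      D.pairing (.some x y h) (.some x y h) = padicLog 2 ((x.den : ℚ) : ℚ_[2]) - padicLog 2 (padicEval Sq (-(x : ℚ_[2]) / y)))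
    {x y : ℚ} (h : V.toAffine.Nonsingular x y) (hx : ‖(x : ℚ_[2])‖ = 4)
    (hns : ∀ ℓ : ℕ, ℓ.Prime → V.HasNonsingularReductionAt ℓ x y) (a2 : ℤ) (ha2 : V.a₂ = a2) (hodd : Odd a2) :
    D.pairing (.some x y h) (.some x y h) ≠ 0 := by
  intro h0'
  have := (norm_pairing_eq_quarter_iff_of_norm_eq_four V ha1 Sq h0 h1 h2 h3 hODE D hD h hx hns a2 ha2).mpr hodd
  rw [h0', norm_zero] at this
  norm_num at this

end NaiveSigmaLogAtTwo

end Summit.BirchSwinnertonDyer.BirchSwinnertonDyer.Theorems
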